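import Literature.NumberTheory.Transcendental.KZFibredRelations
import Literature.NumberTheory.Transcendental.KZProductIdeal
import Summits.KontsevichZagierPeriods.KontsevichZagierPeriods.Theorems.TerasomaMultiplicationBetaCancellationStubPiMulFibred
import Summits.KontsevichZagierPeriods.KontsevichZagierPeriods.Theorems.LiouvilleUnfoldingAyoubPiCancellationStubSpreadLift

/-!
# Crux stmt-KontsevichZagierPeriods-0540 (`AyoubSpecialisation.AyoubPiCancellation` ≡ `KZ.PiCancellation`),
# line `Sketch` (idea `moving-segment-wronskian`): stub `stub_spreadOfRelation`

Support file (`--supports` stmt-KontsevichZagierPeriods-0540) of the line skeleton, registered stub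
`stub_spreadOfRelation` (M, the converse bookkeeping making "(B) ⟺ crux" a tree theorem): the
THREE-leading-coordinates analogue of the tree theorems `BetaCancellationLine.stub_piMulFibred`
(two leading disc coordinates) and `AyoubPiCancellationLine.extAnn_lift_mem_fibredRelations` (one
leading interval coordinate).

**The spread of a relation is a `q`-fibred relation.** Let `a b` be rationals and `V` the pinned
MOVING-SEGMENT SPREAD family over the wall positions `q ∈ (a, b)`: `V n r : IntegralRep (n + 3)` has
domain `{z | (a < z₀ < b) ∧ z₁² + z₂² ≤ 1 ∧ z₁ < z₀ ∧ (z₃, …, z_{n+2}) ∈ r.domain}` (the spread solid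
`W` in the coordinates `0, 1, 2` — wall position `q = z₀`, disc `(z₁, z₂)`, cut `z₁ < z₀` — times
`r.domain` in the trailing block) and integrand `z ↦ r.integrand (z₃, …)`. Then
`FreeAbelianGroup.lift (of ∘ V)` maps `KZ.relations` into `KZ.fibredRelations`: by
`AddSubgroup.closure_le` it suffices to treat one generator of each of the four kinds
[Kontsevich–Zagier 2001, §1.2, rules (1)–(3)] (the conditions of `W` never interact with the moves):
domain additivity ↦ domain additivity in dimension `k + 3` (`spreadOfRelation_domainAdd`; the
overlap lies in the cylinder over the null set `σ₁ ∩ σ₂` of the trailing block,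
`spreadOfRelation_volume_setOf_tail_mem`); integrand additivity ↦ integrand additivity
(`spreadOfRelation_integrandAdd`); a change of variables `Φ` on `r.domain ⊆ ℝᵏ` ↦
`Ψ z = (z₀, z₁, z₂, Φ (z₃, …))` between representations of dimension `(k + 2) + 1`, block
derivative `id × Φ'` conjugated by `ℝ³ × ℝᵏ ≃ ℝ^{k+3}`, `|det Ψ'| = |det Φ'|`, `Ψ z 0 = z 0` — a
FIBRED change of variables (`spreadOfRelation_changeOfVariables`); Newton–Leibniz (band
`r : IntegralRep (k + 1)` over `r' : IntegralRep k`) ↦ Newton–Leibniz along the last coordinate of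
`V (k+1) r : IntegralRep ((k+3)+1)` over the base `V k r' : IntegralRep ((k+2)+1)` — a FIBRED
Newton–Leibniz move (`spreadOfRelation_newtonLeibniz`, `KZ.of_sub_of_mem_fibredNewtonLeibnizRel`).
No definitions; sorry-free; axioms ⊆ {propext, Classical.choice, Quot.sound}.

References: M. Kontsevich, D. Zagier, *Periods* (2001), §1.2 rules (1)–(3), §4.1; J. Ayoub, *Une
version relative de la conjecture des périodes de Kontsevich–Zagier*, Ann. of Math. 181 (2015), §1.
-/

noncomputable section

-- `Summit.KontsevichZagierPeriods.KontsevichZagierPeriods.…` is the tree's mandated layout (single-conjunct summit).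
set_option linter.dupNamespace false

namespace Summit.KontsevichZagierPeriods.KontsevichZagierPeriods.AyoubPiCancellationLine

open Set MeasureTheory
open Literature.NumberTheory.Transcendental
open Literature.NumberTheory.Transcendental.KZ
open Literature.ModelTheory.ExponentialFields (IsSemialgebraic)
open MvPolynomial (X)
open Summit.KontsevichZagierPeriods.KontsevichZagierPeriods.BetaCancellationLine
  (piMulFib_volume_setOf_comp_equiv)

-- adapted from Summits/KontsevichZagierPeriods/KontsevichZagierPeriods/Theorems/TerasomaMultiplicationBetaCancellationStubPiMulFibred.lean
-- (two leading disc coordinates replaced by three: wall position `z 0`, disc `z 1, z 2`, cut `z 1 < z 0`)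

variable {k : ℕ}

/-! ### §1 The trailing block `z ↦ (z₃, …, z_{k+2})` of `ℝ^{k+3}` -/

/-- **The cylinder over a null set of the trailing block is null**: if `N ⊆ ℝᵏ` is Lebesgue-null
then so is `{z ∈ ℝ^{k+3} | (z₃, …, z_{k+2}) ∈ N}` (`KZ.volume_cylinder`: `vol (ℝ³ × N) = ∞ · 0 = 0`,
transported along `Fin (3 + k) ≃ Fin (k + 3)`, `spreadLift_idx_natAdd`). [folklore] -/
theorem spreadOfRelation_volume_setOf_tail_mem {N : Set (Fin k → ℝ)} (hN : volume N = 0) :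
    volume {z : Fin (k + 3) → ℝ | (fun i : Fin k => z i.succ.succ.succ) ∈ N} = 0 := by
  have hC : {z : Fin (k + 3) → ℝ | (fun i : Fin k => z i.succ.succ.succ) ∈ N} =
      {w : Fin (k + 3) → ℝ | (fun i => w (finCongr (Nat.add_comm 3 k) i)) ∈
        {z : Fin (3 + k) → ℝ | (fun i => z (Fin.castAdd k i)) ∈ (univ : Set (Fin 3 → ℝ)) ∧
          (fun j => z (Fin.natAdd 3 j)) ∈ N}} := by
    ext w
    simp only [mem_setOf_eq, mem_univ, true_and, spreadLift_idx_natAdd]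
  rw [hC, piMulFib_volume_setOf_comp_equiv, volume_cylinder, hN, mul_zero]

/-- The trailing-block projection `ℝ^{k+3} → ℝᵏ` is a `ℚ`-semialgebraic (coordinate, polynomial)
map on every `ℚ`-semialgebraic set. [folklore] -/
theorem spreadOfRelation_isSemialgebraicMapOn_tail {S : Set (Fin (k + 3) → ℝ)}
    (hS : IsSemialgebraic ℚ S) :
    IsSemialgebraicMapOn ℚ S (fun z : Fin (k + 3) → ℝ => fun i : Fin k => z i.succ.succ.succ) := by
  convert isSemialgebraicMapOn_aeval hS
    (fun i : Fin k => (X i.succ.succ.succ : MvPolynomial (Fin (k + 3)) ℚ)) using 2 with z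
  ext i
  simp

/-- A `ℚ`-semialgebraic function of the trailing block, `z ↦ G (z₃, …, z_{k+2})`, is
`ℚ`-semialgebraic on every `ℚ`-semialgebraic set whose trailing blocks lie in the domain of `G`
(composition with a semialgebraic map, `IsSemialgebraicFunOn.comp_isSemialgebraicMapOn_holds`;
Tarski–Seidenberg). [folklore] -/
theorem spreadOfRelation_isSemialgebraicFunOn_comp_tail {S : Set (Fin (k + 3) → ℝ)}
    {B : Set (Fin k → ℝ)} {G : (Fin k → ℝ) → ℝ} (hS : IsSemialgebraic ℚ S)
    (hG : IsSemialgebraicFunOn ℚ B G) (hSB : ∀ z ∈ S, (fun i : Fin k => z i.succ.succ.succ) ∈ B) :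
    IsSemialgebraicFunOn ℚ S (fun z => G (fun i : Fin k => z i.succ.succ.succ)) :=
  IsSemialgebraicFunOn.comp_isSemialgebraicMapOn_holds hG
    (spreadOfRelation_isSemialgebraicMapOn_tail hS) hSB

/-- On `ℝ^{(k+3)+1}`: dropping the last coordinate does not touch coordinate `0`. [folklore] -/
theorem spreadOfRelation_init_apply_zero (z : Fin (k + 3 + 1) → ℝ) : Fin.init z 0 = z 0 := rfl

/-- On `ℝ^{(k+3)+1}`: dropping the last coordinate does not touch coordinate `1`. [folklore] -/
theorem spreadOfRelation_init_apply_one (z : Fin (k + 3 + 1) → ℝ) : Fin.init z 1 = z 1 := rfl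

/-- On `ℝ^{(k+3)+1}`: dropping the last coordinate does not touch coordinate `2`. [folklore] -/
theorem spreadOfRelation_init_apply_two (z : Fin (k + 3 + 1) → ℝ) : Fin.init z 2 = z 2 := rfl

/-- On `ℝ^{(k+3)+1}`: the trailing block commutes with dropping the last coordinate,
`init (z₃, …) = ((init z)₃, …)`. [folklore] -/
theorem spreadOfRelation_init_tail (z : Fin (k + 3 + 1) → ℝ) :
    Fin.init (fun i : Fin (k + 1) => z i.succ.succ.succ) =
      fun i : Fin k => Fin.init z i.succ.succ.succ := rfl

/-- On `ℝ^{(k+3)+1}`: the last coordinate of the trailing block is the last one. [folklore] -/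
theorem spreadOfRelation_tail_last (z : Fin (k + 3 + 1) → ℝ) :
    z (Fin.last k).succ.succ.succ = z (Fin.last (k + 3)) := rfl

/-- On `ℝ^{(k+3)+1}`: the trailing block of `(x, t)` is `((x₃, …), t)`. [folklore] -/
theorem spreadOfRelation_tail_snoc (x : Fin (k + 3) → ℝ) (t : ℝ) :
    (fun i : Fin (k + 1) => (Fin.snoc x t : Fin (k + 3 + 1) → ℝ) i.succ.succ.succ) =
      Fin.snoc (fun i : Fin k => x i.succ.succ.succ) t := by
  ext i
  refine Fin.lastCases ?_ (fun j => ?_) i <;>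
    simp only [Fin.succ_last, Fin.snoc_last, Fin.succ_castSucc, Fin.snoc_castSucc]

/-! ### §2 The four moves under the pinned spread family -/

section Generators

variable {a b : ℚ} {V : ∀ n : ℕ, IntegralRep n → IntegralRep (n + 3)}
  (hV : ∀ (n : ℕ) (r : IntegralRep n),
    (V n r).domain = {z : Fin (n + 3) → ℝ | ((a : ℝ) < z 0 ∧ z 0 < b) ∧ z 1 ^ 2 + z 2 ^ 2 ≤ 1 ∧
      z 1 < z 0 ∧ (fun i : Fin n => z i.succ.succ.succ) ∈ r.domain} ∧
    (V n r).integrand = fun z => r.integrand (fun i : Fin n => z i.succ.succ.succ))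
include hV

/-- **Spread solid × (domain additivity) is domain additivity**: `W × (σ₁ ∪ σ₂) = (W × σ₁) ∪ (W × σ₂)`,
the overlap lies in the cylinder over the null set `σ₁ ∩ σ₂`, and the integrands `f ∘ pr`,
`fᵢ ∘ pr` agree on `W × σᵢ`. [cite: KontsevichZagier2001, §1.2 rule (1)] -/
theorem spreadOfRelation_domainAdd {r r₁ r₂ : IntegralRep k}
    (hdom : r.domain = r₁.domain ∪ r₂.domain) (hnull : volume (r₁.domain ∩ r₂.domain) = 0)
    (h₁ : EqOn r.integrand r₁.integrand r₁.domain) (h₂ : EqOn r.integrand r₂.integrand r₂.domain) :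
    of (V k r) - of (V k r₁) - of (V k r₂) ∈ domainAddRel := by
  obtain ⟨⟨hD, hI⟩, ⟨hD₁, hI₁⟩, ⟨hD₂, hI₂⟩⟩ := And.intro (hV k r) (And.intro (hV k r₁) (hV k r₂))
  refine ⟨k + 3, V k r, V k r₁, V k r₂, ?_, ?_, ?_, ?_, rfl⟩
  · rw [hD, hD₁, hD₂]; ext z
    simp only [hdom, mem_union, mem_setOf_eq]; tauto
  · refine measure_mono_null (fun z hz => ?_) (spreadOfRelation_volume_setOf_tail_mem hnull)
    rw [hD₁, hD₂] at hz
    exact ⟨hz.1.2.2.2, hz.2.2.2.2⟩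
  · intro z hz
    rw [hD₁] at hz; rw [hI, hI₁]
    exact h₁ hz.2.2.2
  · intro z hz
    rw [hD₂] at hz; rw [hI, hI₂]
    exact h₂ hz.2.2.2

/-- **Spread solid × (integrand additivity) is integrand additivity**:
`(f₁ + f₂) ∘ pr = f₁ ∘ pr + f₂ ∘ pr` on `W × σ`. [cite: KontsevichZagier2001, §1.2 rule (1)] -/
theorem spreadOfRelation_integrandAdd {r r₁ r₂ : IntegralRep k} (h₁ : r₁.domain = r.domain)
    (h₂ : r₂.domain = r.domain) (hadd : EqOn r.integrand (r₁.integrand + r₂.integrand) r.domain) :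
    of (V k r) - of (V k r₁) - of (V k r₂) ∈ integrandAddRel := by
  obtain ⟨⟨hD, hI⟩, ⟨hD₁, hI₁⟩, ⟨hD₂, hI₂⟩⟩ := And.intro (hV k r) (And.intro (hV k r₁) (hV k r₂))
  refine ⟨k + 3, V k r, V k r₁, V k r₂, ?_, ?_, ?_, rfl⟩
  · rw [hD₁, hD, h₁]
  · rw [hD₂, hD, h₂]
  · intro z hz
    rw [hD] at hz; rw [hI, hI₁, hI₂]
    exact hadd hz.2.2.2

/-- **Spread solid × (change of variables) is a FIBRED change of variables.** For `Φ` on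
`σ = r.domain ⊆ ℝᵏ` as in rule (2), the map `Ψ z = (z₀, z₁, z₂, Φ (z₃, …))` on `W × σ ⊆ ℝ^{k+3}`
(`W` the spread solid) is `ℚ`-semialgebraic, injective, has derivative `id × Φ'` within `W × σ`
(chain rule through `ℝ³ × ℝᵏ ≃ ℝ^{k+3}`), image `W × Φ '' σ`, `|det (id × Φ')| = |det Φ'|`
(`LinearMap.det_conj`, `LinearMap.det_prodMap`), so `f ∘ pr = ((f' ∘ pr) ∘ Ψ) · |det Ψ'|`; and `Ψ`
preserves the parameter coordinate `z₀`. [cite: KontsevichZagier2001, §1.2 rule (2)] -/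
theorem spreadOfRelation_changeOfVariables {r r' : IntegralRep k} {Φ : (Fin k → ℝ) → (Fin k → ℝ)}
    {Φ' : (Fin k → ℝ) → (Fin k → ℝ) →L[ℝ] (Fin k → ℝ)} (hΦ : IsSemialgebraicMapOn ℚ r.domain Φ)
    (hΦ' : ∀ x ∈ r.domain, HasFDerivWithinAt Φ (Φ' x) r.domain x) (hinj : InjOn Φ r.domain)
    (hdom : r'.domain = Φ '' r.domain)
    (hf : ∀ x ∈ r.domain, r.integrand x = r'.integrand (Φ x) * |(Φ' x).det|) :
    of (V k r) - of (V k r') ∈ fibredChangeOfVariablesRel := by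
  obtain ⟨⟨hD, hI⟩, ⟨hD', hI'⟩⟩ := And.intro (hV k r) (hV k r')
  -- the linear identification `ℝ³ × ℝᵏ ≃ ℝ^{k+3}` (solid coordinates first)
  let e : ((Fin 3 → ℝ) × (Fin k → ℝ)) ≃ₗ[ℝ] (Fin (k + 3) → ℝ) :=
    { toFun := fun p => Fin.cons (p.1 0) (Fin.cons (p.1 1) (Fin.cons (p.1 2) p.2))
      invFun := fun z => (![z 0, z 1, z 2], fun i => z i.succ.succ.succ)
      map_add' := fun p q => by
        ext j
        refine Fin.cases ?_ (fun j => Fin.cases ?_ (fun j => Fin.cases ?_ (fun i => ?_) j) j) j <;>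
          rfl
      map_smul' := fun c p => by
        ext j
        refine Fin.cases ?_ (fun j => Fin.cases ?_ (fun j => Fin.cases ?_ (fun i => ?_) j) j) j <;>
          rfl
      left_inv := fun p => by
        ext j
        · fin_cases j <;> rfl
        · rfl
      right_inv := fun z => by
        ext j
        refine Fin.cases ?_ (fun j => Fin.cases ?_ (fun j => Fin.cases ?_ (fun i => ?_) j) j) j <;>
          rfl }
  let eL : ((Fin 3 → ℝ) × (Fin k → ℝ)) ≃L[ℝ] (Fin (k + 3) → ℝ) := e.toContinuousLinearEquiv
  have heL_symm : ∀ z, eL.symm z = (![z 0, z 1, z 2], fun i => z i.succ.succ.succ) := fun z => rfl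
  -- the spread solid in the three leading coordinates
  let W : Set (Fin 3 → ℝ) :=
    {w | ((a : ℝ) < w 0 ∧ w 0 < b) ∧ w 1 ^ 2 + w 2 ^ 2 ≤ 1 ∧ w 1 < w 0}
  -- the block map and its derivative
  let Ψ : (Fin (k + 3) → ℝ) → (Fin (k + 3) → ℝ) := eL ∘ Prod.map id Φ ∘ eL.symm
  let Ψ' : (Fin (k + 3) → ℝ) → (Fin (k + 3) → ℝ) →L[ℝ] (Fin (k + 3) → ℝ) := fun z =>
    (eL : _ →L[ℝ] _).comp ((((ContinuousLinearMap.id ℝ (Fin 3 → ℝ)).prodMap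
      (Φ' (fun i => z i.succ.succ.succ))).comp (eL.symm : _ →L[ℝ] _)))
  have hΨ : ∀ z, Ψ z =
      Fin.cons (z 0) (Fin.cons (z 1) (Fin.cons (z 2) (Φ fun i => z i.succ.succ.succ))) :=
    fun z => rfl
  have hΨ0 : ∀ z, Ψ z 0 = z 0 := fun z => rfl
  have hΨ1 : ∀ z, Ψ z 1 = z 1 := fun z => rfl
  have hΨ2 : ∀ z, Ψ z 2 = z 2 := fun z => rfl
  have hΨ3 : ∀ z (i : Fin k), Ψ z i.succ.succ.succ = Φ (fun i => z i.succ.succ.succ) i :=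
    fun z i => by rw [hΨ, Fin.cons_succ, Fin.cons_succ, Fin.cons_succ]
  have hdet : ∀ z, (Ψ' z).det = (Φ' (fun i => z i.succ.succ.succ)).det := by
    intro z
    have hcoe : ((Ψ' z : (Fin (k + 3) → ℝ) →L[ℝ] (Fin (k + 3) → ℝ)) :
        (Fin (k + 3) → ℝ) →ₗ[ℝ] (Fin (k + 3) → ℝ)) =
      (e : ((Fin 3 → ℝ) × (Fin k → ℝ)) →ₗ[ℝ] (Fin (k + 3) → ℝ)) ∘ₗ
        (((LinearMap.id : (Fin 3 → ℝ) →ₗ[ℝ] (Fin 3 → ℝ)).prodMap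
          ((Φ' (fun i => z i.succ.succ.succ) : (Fin k → ℝ) →L[ℝ] (Fin k → ℝ)) :
            (Fin k → ℝ) →ₗ[ℝ] (Fin k → ℝ))) ∘ₗ
        (e.symm : (Fin (k + 3) → ℝ) →ₗ[ℝ] ((Fin 3 → ℝ) × (Fin k → ℝ)))) :=
      LinearMap.ext fun v => rfl
    change LinearMap.det _ = LinearMap.det _
    rw [hcoe, LinearMap.det_conj, LinearMap.det_prodMap, LinearMap.det_id, one_mul]
  have hS : (V k r).domain = eL.symm ⁻¹' (W ×ˢ r.domain) := by
    ext z
    rw [hD, mem_preimage, heL_symm, mem_prod]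
    simp only [mem_setOf_eq, W, Matrix.cons_val_zero, Matrix.cons_val_one, Matrix.head_cons,
      Matrix.cons_val_two, Matrix.tail_cons, and_assoc]
  have hDs : IsSemialgebraic ℚ (V k r).domain := (V k r).isSemialgebraic_domain
  have hmaps : ∀ z ∈ (V k r).domain, (fun i : Fin k => z i.succ.succ.succ) ∈ r.domain :=
    fun z hz => by rw [hD] at hz; exact hz.2.2.2
  refine ⟨k + 2, V k r, V k r', Ψ, Ψ', ?_, ?_, ?_, ?_, ?_, ?_, rfl⟩
  · -- semialgebraic, coordinatewise
    refine IsSemialgebraicMapOn.of_forall hDs fun j => ?_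
    refine Fin.cases ?_ (fun j => Fin.cases ?_ (fun j => Fin.cases ?_ (fun i => ?_) j) j) j
    · simp only [hΨ0]
      convert isSemialgebraicFunOn_aeval hDs (X 0 : MvPolynomial (Fin (k + 3)) ℚ) using 2 with z
      simp
    · simp only [Fin.succ_zero_eq_one, hΨ1]
      convert isSemialgebraicFunOn_aeval hDs (X 1 : MvPolynomial (Fin (k + 3)) ℚ) using 2 with z
      simp
    · simp only [Fin.succ_zero_eq_one, Fin.succ_one_eq_two, hΨ2]
      convert isSemialgebraicFunOn_aeval hDs (X 2 : MvPolynomial (Fin (k + 3)) ℚ) using 2 with z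
      simp
    · simp only [hΨ3]
      exact spreadOfRelation_isSemialgebraicFunOn_comp_tail hDs
        ((isSemialgebraicMapOn_iff_forall_holds r.isSemialgebraic_domain).mp hΦ i) hmaps
  · -- derivative within the cylinder
    intro z hz
    have hx : (fun i => z i.succ.succ.succ) ∈ r.domain := hmaps z hz
    have hg : HasFDerivWithinAt (Prod.map id Φ)
        ((ContinuousLinearMap.id ℝ (Fin 3 → ℝ)).prodMap (Φ' (fun i => z i.succ.succ.succ)))
        (W ×ˢ r.domain) (eL.symm z) := by
      refine HasFDerivWithinAt.prodMap (eL.symm z) (hasFDerivWithinAt_id _ _) ((hΦ' _ hx).mono ?_)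
      rintro _ ⟨q, hq, rfl⟩
      exact hq.2
    have h2 := (eL.comp_hasFDerivWithinAt_iff).mpr hg
    rw [hS]
    exact (eL.symm.comp_right_hasFDerivWithinAt_iff (f := eL ∘ Prod.map id Φ)).mpr h2
  · -- injective
    intro z₁ hz₁ z₂ hz₂ h
    have h0 : z₁ 0 = z₂ 0 := by rw [← hΨ0 z₁, ← hΨ0 z₂, h]
    have h1 : z₁ 1 = z₂ 1 := by rw [← hΨ1 z₁, ← hΨ1 z₂, h]
    have h2 : z₁ 2 = z₂ 2 := by rw [← hΨ2 z₁, ← hΨ2 z₂, h]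
    have h3 : Φ (fun i => z₁ i.succ.succ.succ) = Φ (fun i => z₂ i.succ.succ.succ) := by
      funext i
      rw [← hΨ3 z₁, ← hΨ3 z₂, h]
    have htl := hinj (hmaps z₁ hz₁) (hmaps z₂ hz₂) h3
    funext j
    exact Fin.cases h0 (fun j => Fin.cases h1 (fun j => Fin.cases h2 (fun i => congrFun htl i) j) j) j
  · -- image
    ext w
    rw [hD', hD, mem_setOf_eq, mem_image]
    constructor
    · rintro ⟨hw, hw₁, hw₂, hw'⟩
      rw [hdom] at hw'
      obtain ⟨x, hx, hwx⟩ := hw'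
      refine ⟨Fin.cons (w 0) (Fin.cons (w 1) (Fin.cons (w 2) x)), ?_, ?_⟩
      · exact ⟨hw, hw₁, hw₂, by simpa only [Fin.cons_succ] using hx⟩
      · rw [hΨ]
        funext j
        refine Fin.cases rfl (fun j => Fin.cases rfl (fun j => Fin.cases rfl (fun i => ?_) j) j) j
        simp only [Fin.cons_succ]
        exact congrFun hwx i
    · rintro ⟨z, ⟨hz, hz₁, hz₂, hz'⟩, rfl⟩
      refine ⟨hz, hz₁, hz₂, ?_⟩
      simp only [hΨ3]
      rw [hdom]
      exact mem_image_of_mem Φ hz'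
  · -- integrands
    intro z hz
    rw [hI, hI', hdet]
    simp only [hΨ3]
    exact hf _ (hmaps z hz)
  · -- the parameter coordinate is preserved
    exact fun z _ => hΨ0 z

/-- **Spread solid × (Newton–Leibniz) is a FIBRED Newton–Leibniz move.** If `[r] − [r']` is rule (3)
along the last coordinate over the base `τ' = r'.domain ⊆ ℝᵏ` with bounds `α ≤ β` and primitive
`F`, then `W × band ⊆ ℝ^{(k+3)+1}` is the band over the base `W × τ' ⊆ ℝ^{(k+2)+1}` with bounds
`α ∘ pr`, `β ∘ pr` and primitive `F ∘ pr` (the solid block sits in front and is untouched), so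
`[V r] − [V r']` is Newton–Leibniz over a base of dimension `≥ 1`.
[cite: KontsevichZagier2001, §1.2 rule (3)] -/
theorem spreadOfRelation_newtonLeibniz {r : IntegralRep (k + 1)} {r' : IntegralRep k}
    {α β : (Fin k → ℝ) → ℝ} {F : (Fin (k + 1) → ℝ) → ℝ} (hF : IsSemialgebraicFunOn ℚ r.domain F)
    (hα : IsSemialgebraicFunOn ℚ r'.domain α) (hβ : IsSemialgebraicFunOn ℚ r'.domain β)
    (hle : ∀ x ∈ r'.domain, α x ≤ β x)
    (hdom : r.domain = {z | (Fin.init z : Fin k → ℝ) ∈ r'.domain ∧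
      α (Fin.init z) ≤ z (Fin.last k) ∧ z (Fin.last k) ≤ β (Fin.init z)})
    (hcont : ∀ x ∈ r'.domain, ContinuousOn (fun t : ℝ => F (Fin.snoc x t)) (Icc (α x) (β x)))
    (hderiv : ∀ x ∈ r'.domain, ∀ t ∈ Ioo (α x) (β x),
      HasDerivAt (fun s : ℝ => F (Fin.snoc x s)) (r.integrand (Fin.snoc x t)) t)
    (hr' : ∀ x ∈ r'.domain, r'.integrand x = F (Fin.snoc x (β x)) - F (Fin.snoc x (α x))) :
    of (V (k + 1) r) - of (V k r') ∈ fibredNewtonLeibnizRel := by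
  obtain ⟨⟨hD, hI⟩, ⟨hD', hI'⟩⟩ := And.intro (hV (k + 1) r) (hV k r')
  -- the band, retyped over `ℝ^{(k+3)+1}`
  have hD3 : ∀ z : Fin (k + 3 + 1) → ℝ, z ∈ (V (k + 1) r).domain ↔
      ((a : ℝ) < z 0 ∧ z 0 < b) ∧ z 1 ^ 2 + z 2 ^ 2 ≤ 1 ∧ z 1 < z 0 ∧
        (fun i : Fin (k + 1) => z i.succ.succ.succ) ∈ r.domain := fun z => by
    rw [hD]; rfl
  have hmaps' : ∀ w ∈ (V k r').domain, (fun i : Fin k => w i.succ.succ.succ) ∈ r'.domain :=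
    fun w hw => by rw [hD'] at hw; exact hw.2.2.2
  refine of_sub_of_mem_fibredNewtonLeibnizRel ⟨k + 3, V (k + 1) r, V k r',
    fun w => α (fun i => w i.succ.succ.succ), fun w => β (fun i => w i.succ.succ.succ),
    fun z => F (fun i => z i.succ.succ.succ), ?_, ?_, ?_, ?_, ?_, ?_, ?_, ?_, rfl⟩
  · exact spreadOfRelation_isSemialgebraicFunOn_comp_tail (V (k + 1) r).isSemialgebraic_domain hF
      (fun z hz => ((hD3 z).mp hz).2.2.2)
  · exact spreadOfRelation_isSemialgebraicFunOn_comp_tail (V k r').isSemialgebraic_domain hα hmaps'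
  · exact spreadOfRelation_isSemialgebraicFunOn_comp_tail (V k r').isSemialgebraic_domain hβ hmaps'
  · exact fun w hw => hle _ (hmaps' w hw)
  · ext z; rw [hD3]
    simp only [mem_setOf_eq, hD', hdom, spreadOfRelation_init_apply_zero,
      spreadOfRelation_init_apply_one, spreadOfRelation_init_apply_two, spreadOfRelation_init_tail,
      spreadOfRelation_tail_last]
    tauto
  · intro w hw
    simp only [spreadOfRelation_tail_snoc]
    exact hcont _ (hmaps' w hw)
  · intro w hw t ht
    simp only [hI, spreadOfRelation_tail_snoc]
    exact hderiv _ (hmaps' w hw) t ht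
  · intro w hw
    rw [hI']
    simp only [spreadOfRelation_tail_snoc]
    exact hr' _ (hmaps' w hw)

end Generators

/-! ### §3 The stub -/

/-- **STUB `stub_spreadOfRelation` (the spread of a relation is a `q`-fibred relation)**: for every
pinned spread family `V` over any wall interval `(a, b)`, `FreeAbelianGroup.lift (of ∘ V)` maps
`KZ.relations` into `KZ.fibredRelations` (`AddSubgroup.closure_le`; generatorwise
`spreadOfRelation_domainAdd`, `spreadOfRelation_integrandAdd`, `spreadOfRelation_changeOfVariables`,
`spreadOfRelation_newtonLeibniz`). [folklore] -/
theorem stub_spreadOfRelation : ∀ (a b : ℚ) (V : ∀ n : ℕ, IntegralRep n → IntegralRep (n + 3)),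
    (∀ (n : ℕ) (r : IntegralRep n),
      (V n r).domain = {z : Fin (n + 3) → ℝ | ((a : ℝ) < z 0 ∧ z 0 < b) ∧ z 1 ^ 2 + z 2 ^ 2 ≤ 1 ∧
        z 1 < z 0 ∧ (fun i : Fin n => z i.succ.succ.succ) ∈ r.domain} ∧
      (V n r).integrand = fun z => r.integrand (fun i : Fin n => z i.succ.succ.succ)) →
    ∀ c : FormalRep, c ∈ relations →
      FreeAbelianGroup.lift (fun s : (Σ n, IntegralRep n) => of (V s.1 s.2)) c ∈ fibredRelations := by
  intro a b V hV c hc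
  have hL : ∀ {m : ℕ} (s : IntegralRep m),
      FreeAbelianGroup.lift (fun s : (Σ n, IntegralRep n) => of (V s.1 s.2)) (of s) = of (V m s) :=
    fun s => FreeAbelianGroup.lift_apply_of _ _
  refine (AddSubgroup.closure_le (fibredRelations.comap
    (FreeAbelianGroup.lift (fun s : (Σ n, IntegralRep n) => of (V s.1 s.2))))).mpr ?_ hc
  rintro g (((hg | hg) | hg) | hg)
  · obtain ⟨k, r, r₁, r₂, hdom, hnull, h₁, h₂, rfl⟩ := hg
    rw [AddSubgroup.coe_comap, mem_preimage, map_sub, map_sub, hL, hL, hL]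
    exact mem_fibredRelations_of_mem_domainAddRel (spreadOfRelation_domainAdd hV hdom hnull h₁ h₂)
  · obtain ⟨k, r, r₁, r₂, h₁, h₂, hadd, rfl⟩ := hg
    rw [AddSubgroup.coe_comap, mem_preimage, map_sub, map_sub, hL, hL, hL]
    exact mem_fibredRelations_of_mem_integrandAddRel (spreadOfRelation_integrandAdd hV h₁ h₂ hadd)
  · obtain ⟨k, r, r', Φ, Φ', hΦ, hΦ', hinj, hdom, hf, rfl⟩ := hg
    rw [AddSubgroup.coe_comap, mem_preimage, map_sub, hL, hL]
    exact mem_fibredRelations_of_mem_fibredChangeOfVariablesRel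
      (spreadOfRelation_changeOfVariables hV hΦ hΦ' hinj hdom hf)
  · obtain ⟨k, r, r', α, β, F, hF, hα, hβ, hle, hband, hcont, hderiv, hr', rfl⟩ := hg
    rw [AddSubgroup.coe_comap, mem_preimage, map_sub, hL, hL]
    exact mem_fibredRelations_of_mem_fibredNewtonLeibnizRel
      (spreadOfRelation_newtonLeibniz hV hF hα hβ hle hband hcont hderiv hr')

end Summit.KontsevichZagierPeriods.KontsevichZagierPeriods.AyoubPiCancellationLine
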